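import Summits.BirchSwinnertonDyer.BirchSwinnertonDyer.Theorems.ManinLocalTwoThreeIstarDiscriminantValuesTwo
import Summits.BirchSwinnertonDyer.BirchSwinnertonDyer.Theorems.ManinLocalTwoThreeConductorExponentFourAtTwo
import HarnessLib

/-!
# The Papadopoulos menu at `2`: every additive Kodaira type with its possible `ord₂ Δ_min`, and the type lists for `f₂ ∈ {5, 6, 7, 8}`
# (route `ManinLocalTwoThree`, crux C2 `ManinOddAtFour` stmt-BirchSwinnertonDyer-22967; cell bsd-f2-manin, p3 gen 12)

At an absolutely unramified `2`-adic place (perfect residue field) an additive elliptic curve has (type, `ord Δ_min`) in the finite menu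
`II {4,6,7}`, `III {4,6,8,9}`, `IV {4}`, `I₀* {8,9,10}`, `I₁* {8}`, `I₂* {10,12,13}`, `I₃* {11,12}`, `Iₙ* {n+8, n+10}` (`n ≥ 4`), `IV* {8}`,
`III* {10,12,14,15}`, `II* {11,12,14}` (`kodairaSymbolAt_ordMinimalDiscriminant_menu_of_irreducible_two`; the tree's `KodairaDiscriminantValuesTwoProofs`
plus the sibling `…IstarDiscriminantValuesTwo` for `Iₙ*`).  With the tree's Ogg-as-definition `f = ord Δ_min + 1 − m` the type lists follow:
**`f₂ = 5`: `III/6`, `I₀*/9`, `I₃*/12`, `III*/12`; `f₂ = 6`: `II/6`, `I₀*/10`, `I₂*/12`, `II*/14`, `Iₙ*/(n+10)` (`n ≥ 4`); `f₂ = 7`: `II/7`, `III/8`,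
`I₂*/13`, `III*/14`; `f₂ = 8`: `III/9`, `III*/15`** (the `f₂ = 4` list is the sibling `kodairaSymbolAt_of_conductorExponent_eq_four_two`, `f₂ = 3`
is p2's `…ConductorExponentThreeAtTwo`).  These are the `32 ∣ N` strata of an's `ManinOddAtSixteen`.
HONEST FRAMING: local bookkeeping in print (Papadopoulos 1993 Table IV), kernel-checked; nothing about BSD or Manin's conjecture is proved; C2 OPEN.
[cite: Papadopoulos1993, Table IV (p = 2)] [cite: SilvermanATAEC1994, IV.9.4 and Table 4.1, IV.11.1]
-/

set_option autoImplicit false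
-- lint-debt: the directory name repeats the summit name (sibling precedent `ManinLocalTwoThreeConductorExponentThreeAtTwo.lean`)
set_option linter.dupNamespace false

noncomputable section

open Polynomial IsLocalRing
open IsDiscreteValuationRing hiding maximalIdeal
open Literature.NumberTheory.DiophantineGeometry Literature.NumberTheory.DiophantineGeometry.TateAlgorithm
  Literature.NumberTheory.DiophantineGeometry.TateAlgorithm.CharTwo Literature.NumberTheory.EllipticCurves

namespace Summit.BirchSwinnertonDyer.BirchSwinnertonDyer.Theorems.ManinLocalTwoThree

section Local

open IsDedekindDomain

variable {A : Type*} [CommRing A] [IsDedekindDomain A] {K : Type*} [Field K] [Algebra A K] [IsFractionRing A K]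
  (v : HeightOneSpectrum A) (W : WeierstrassCurve K)

/-- **The Papadopoulos menu at an absolutely unramified `2`-adic place**: the additive Kodaira types with their possible `ord_v Δ_min`.
[cite: Papadopoulos1993, Table IV (p = 2)] [cite: SilvermanATAEC1994, IV.9.4 and Table 4.1] -/
theorem kodairaSymbolAt_ordMinimalDiscriminant_menu_of_irreducible_two [W.IsElliptic]
    [PerfectField (IsLocalRing.ResidueField (v.adicCompletionIntegers K))]
    (h2 : Irreducible (2 : v.adicCompletionIntegers K)) (hadd : (W.kodairaSymbolAt v).IsAdditive) :
    (W.kodairaSymbolAt v = .II ∧ (W.ordMinimalDiscriminant v = 4 ∨ W.ordMinimalDiscriminant v = 6 ∨ W.ordMinimalDiscriminant v = 7)) ∨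
    (W.kodairaSymbolAt v = .III ∧ (W.ordMinimalDiscriminant v = 4 ∨ W.ordMinimalDiscriminant v = 6 ∨ W.ordMinimalDiscriminant v = 8 ∨
      W.ordMinimalDiscriminant v = 9)) ∨
    (W.kodairaSymbolAt v = .IV ∧ W.ordMinimalDiscriminant v = 4) ∨
    (W.kodairaSymbolAt v = .Istar 0 ∧ (W.ordMinimalDiscriminant v = 8 ∨ W.ordMinimalDiscriminant v = 9 ∨ W.ordMinimalDiscriminant v = 10)) ∨
    (W.kodairaSymbolAt v = .Istar 1 ∧ W.ordMinimalDiscriminant v = 8) ∨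
    (W.kodairaSymbolAt v = .Istar 2 ∧ (W.ordMinimalDiscriminant v = 10 ∨ W.ordMinimalDiscriminant v = 12 ∨ W.ordMinimalDiscriminant v = 13)) ∨
    (W.kodairaSymbolAt v = .Istar 3 ∧ (W.ordMinimalDiscriminant v = 11 ∨ W.ordMinimalDiscriminant v = 12)) ∨
    (∃ n : ℕ, 4 ≤ n ∧ W.kodairaSymbolAt v = .Istar n ∧ (W.ordMinimalDiscriminant v = n + 8 ∨ W.ordMinimalDiscriminant v = n + 10)) ∨
    (W.kodairaSymbolAt v = .IVstar ∧ W.ordMinimalDiscriminant v = 8) ∨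
    (W.kodairaSymbolAt v = .IIIstar ∧ (W.ordMinimalDiscriminant v = 10 ∨ W.ordMinimalDiscriminant v = 12 ∨ W.ordMinimalDiscriminant v = 14 ∨
      W.ordMinimalDiscriminant v = 15)) ∨
    (W.kodairaSymbolAt v = .IIstar ∧ (W.ordMinimalDiscriminant v = 11 ∨ W.ordMinimalDiscriminant v = 12 ∨ W.ordMinimalDiscriminant v = 14)) := by
  have hΔ0 := W.localMinimalIntegralModel_Δ_ne_zero v
  -- types `IV`, `IV*`: `ord Δ = 4`, `8`
  have hIV : W.kodairaSymbolAt v = .IV → W.ordMinimalDiscriminant v = 4 := fun hT ↦ by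
    rw [WeierstrassCurve.kodairaSymbolAt_def] at hT
    obtain ⟨D, -, -, -, -, -, hΔ⟩ := LocalIndex.exists_smul_a_of_kodairaSymbolOfMinimal_eq_IV_of_two h2 _ hT
    rw [addVal_Δ_smul_toNat] at hΔ
    exact hΔ
  have hIVs : W.kodairaSymbolAt v = .IVstar → W.ordMinimalDiscriminant v = 8 := fun hT ↦ by
    rw [WeierstrassCurve.kodairaSymbolAt_def] at hT
    obtain ⟨D, -, -, -, -, -, hΔ⟩ := LocalIndex.exists_smul_a_of_kodairaSymbolOfMinimal_eq_IVstar_of_two h2 _ hT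
    rw [addVal_Δ_smul_toNat] at hΔ
    exact hΔ
  generalize hT : W.kodairaSymbolAt v = T at hadd hIV hIVs
  have hV : (W.localMinimalIntegralModel v).kodairaSymbolOfMinimal = T := by
    rw [← WeierstrassCurve.kodairaSymbolAt_def]; exact hT
  cases T with
  | I n => exact absurd hadd (KodairaSymbol.not_isAdditive_I n)
  | II =>
    have h := LocalIndex.addVal_Δ_toNat_eq_of_kodairaSymbolOfMinimal_eq_II_of_two h2 _ hV
    exact Or.inl ⟨rfl, h⟩
  | III =>
    have h := LocalIndex.addVal_Δ_toNat_eq_of_kodairaSymbolOfMinimal_eq_III_of_two h2 _ hV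
    exact Or.inr (Or.inl ⟨rfl, h⟩)
  | IV => exact Or.inr (Or.inr (Or.inl ⟨rfl, hIV rfl⟩))
  | Istar n =>
    rcases Nat.eq_zero_or_pos n with rfl | hn
    · have h := LocalIndex.addVal_Δ_toNat_eq_of_kodairaSymbolOfMinimal_eq_Istar_zero_of_two h2 _ hΔ0 hV
      exact Or.inr (Or.inr (Or.inr (Or.inl ⟨rfl, h⟩)))
    · rcases addVal_Δ_toNat_eq_of_kodairaSymbolOfMinimal_eq_Istar_of_two h2 _ hV (by omega) with
        ⟨rfl, h⟩ | ⟨rfl, h⟩ | ⟨rfl, h⟩ | ⟨h4, h⟩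
      · exact Or.inr (Or.inr (Or.inr (Or.inr (Or.inl ⟨rfl, h⟩))))
      · exact Or.inr (Or.inr (Or.inr (Or.inr (Or.inr (Or.inl ⟨rfl, h⟩)))))
      · exact Or.inr (Or.inr (Or.inr (Or.inr (Or.inr (Or.inr (Or.inl ⟨rfl, h⟩))))))
      · exact Or.inr (Or.inr (Or.inr (Or.inr (Or.inr (Or.inr (Or.inr (Or.inl ⟨n, h4, rfl, h⟩)))))))
  | IVstar => exact Or.inr (Or.inr (Or.inr (Or.inr (Or.inr (Or.inr (Or.inr (Or.inr (Or.inl ⟨rfl, hIVs rfl⟩))))))))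
  | IIIstar =>
    have h := LocalIndex.addVal_Δ_toNat_eq_of_kodairaSymbolOfMinimal_eq_IIIstar_of_two h2 _ hV
    exact Or.inr (Or.inr (Or.inr (Or.inr (Or.inr (Or.inr (Or.inr (Or.inr (Or.inr (Or.inl ⟨rfl, h⟩)))))))))
  | IIstar =>
    have h := LocalIndex.addVal_Δ_toNat_eq_of_kodairaSymbolOfMinimal_eq_IIstar_of_two h2 _ hV
    exact Or.inr (Or.inr (Or.inr (Or.inr (Or.inr (Or.inr (Or.inr (Or.inr (Or.inr (Or.inr ⟨rfl, h⟩)))))))))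

/-- The menu read through Ogg's formula: for an additive `W` with `f_v = f`, the finitely many (type, `ord Δ_min`) with `ord Δ_min + 1 − m = f`.
(Internal form used by the four lists below.) [cite: Papadopoulos1993, Table IV (p = 2)] [cite: SilvermanATAEC1994, IV.11.1] -/
theorem kodairaSymbolAt_menu_of_conductorExponent_of_irreducible_two [W.IsElliptic]
    [PerfectField (IsLocalRing.ResidueField (v.adicCompletionIntegers K))]
    (h2 : Irreducible (2 : v.adicCompletionIntegers K)) {f : ℕ} (hf2 : 2 ≤ f) (hf : W.conductorExponent v = f) :
    (W.kodairaSymbolAt v = .II ∧ W.ordMinimalDiscriminant v = f ∧ (f = 4 ∨ f = 6 ∨ f = 7)) ∨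
    (W.kodairaSymbolAt v = .III ∧ W.ordMinimalDiscriminant v = f + 1 ∧ (f = 3 ∨ f = 5 ∨ f = 7 ∨ f = 8)) ∨
    (W.kodairaSymbolAt v = .IV ∧ W.ordMinimalDiscriminant v = 4 ∧ f = 2) ∨
    (W.kodairaSymbolAt v = .Istar 0 ∧ W.ordMinimalDiscriminant v = f + 4 ∧ (f = 4 ∨ f = 5 ∨ f = 6)) ∨
    (W.kodairaSymbolAt v = .Istar 1 ∧ W.ordMinimalDiscriminant v = 8 ∧ f = 3) ∨
    (W.kodairaSymbolAt v = .Istar 2 ∧ W.ordMinimalDiscriminant v = f + 6 ∧ (f = 4 ∨ f = 6 ∨ f = 7)) ∨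
    (W.kodairaSymbolAt v = .Istar 3 ∧ W.ordMinimalDiscriminant v = f + 7 ∧ (f = 4 ∨ f = 5)) ∨
    (∃ n : ℕ, 4 ≤ n ∧ W.kodairaSymbolAt v = .Istar n ∧ W.ordMinimalDiscriminant v = n + f + 4 ∧ (f = 4 ∨ f = 6)) ∨
    (W.kodairaSymbolAt v = .IVstar ∧ W.ordMinimalDiscriminant v = 8 ∧ f = 2) ∨
    (W.kodairaSymbolAt v = .IIIstar ∧ W.ordMinimalDiscriminant v = f + 7 ∧ (f = 3 ∨ f = 5 ∨ f = 7 ∨ f = 8)) ∨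
    (W.kodairaSymbolAt v = .IIstar ∧ W.ordMinimalDiscriminant v = f + 8 ∧ (f = 3 ∨ f = 4 ∨ f = 6)) := by
  have hadd : (W.kodairaSymbolAt v).IsAdditive :=
    (W.isAdditive_kodairaSymbolAt_iff_holds v).mpr ((W.two_le_conductorExponent_iff_holds v).mp (by omega))
  have hf' := hf
  unfold WeierstrassCurve.conductorExponent WeierstrassCurve.numComponentsAt at hf'
  rcases kodairaSymbolAt_ordMinimalDiscriminant_menu_of_irreducible_two v W h2 hadd with
      ⟨hK, ho⟩ | ⟨hK, ho⟩ | ⟨hK, ho⟩ | ⟨hK, ho⟩ | ⟨hK, ho⟩ | ⟨hK, ho⟩ | ⟨hK, ho⟩ | ⟨n, hn, hK, ho⟩ | ⟨hK, ho⟩ | ⟨hK, ho⟩ | ⟨hK, ho⟩ <;>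
    rw [hK] at hf' ⊢ <;>
    simp only [KodairaSymbol.numComponents_Istar, show KodairaSymbol.numComponents .II = 1 from rfl,
      show KodairaSymbol.numComponents .III = 2 from rfl, show KodairaSymbol.numComponents .IV = 3 from rfl,
      show KodairaSymbol.numComponents .IVstar = 7 from rfl, show KodairaSymbol.numComponents .IIIstar = 8 from rfl,
      show KodairaSymbol.numComponents .IIstar = 9 from rfl] at hf'
  · exact Or.inl ⟨rfl, by omega, by omega⟩
  · exact Or.inr (Or.inl ⟨rfl, by omega, by omega⟩)
  · exact Or.inr (Or.inr (Or.inl ⟨rfl, by omega, by omega⟩))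
  · exact Or.inr (Or.inr (Or.inr (Or.inl ⟨rfl, by omega, by omega⟩)))
  · exact Or.inr (Or.inr (Or.inr (Or.inr (Or.inl ⟨rfl, by omega, by omega⟩))))
  · exact Or.inr (Or.inr (Or.inr (Or.inr (Or.inr (Or.inl ⟨rfl, by omega, by omega⟩)))))
  · exact Or.inr (Or.inr (Or.inr (Or.inr (Or.inr (Or.inr (Or.inl ⟨rfl, by omega, by omega⟩))))))
  · exact Or.inr (Or.inr (Or.inr (Or.inr (Or.inr (Or.inr (Or.inr (Or.inl ⟨n, hn, rfl, by omega, by omega⟩)))))))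
  · exact Or.inr (Or.inr (Or.inr (Or.inr (Or.inr (Or.inr (Or.inr (Or.inr (Or.inl ⟨rfl, by omega, by omega⟩))))))))
  · exact Or.inr (Or.inr (Or.inr (Or.inr (Or.inr (Or.inr (Or.inr (Or.inr (Or.inr (Or.inl ⟨rfl, by omega, by omega⟩)))))))))
  · exact Or.inr (Or.inr (Or.inr (Or.inr (Or.inr (Or.inr (Or.inr (Or.inr (Or.inr (Or.inr ⟨rfl, by omega, by omega⟩)))))))))

/-- **`f_v = 5` ⟹ `III/6`, `I₀*/9`, `I₃*/12` or `III*/12`.** [cite: Papadopoulos1993, Table IV (p = 2)] [cite: SilvermanATAEC1994, IV.11.1] -/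
theorem kodairaSymbolAt_of_conductorExponent_eq_five_of_irreducible_two [W.IsElliptic]
    [PerfectField (IsLocalRing.ResidueField (v.adicCompletionIntegers K))]
    (h2 : Irreducible (2 : v.adicCompletionIntegers K)) (hf : W.conductorExponent v = 5) :
    (W.kodairaSymbolAt v = .III ∧ W.ordMinimalDiscriminant v = 6) ∨ (W.kodairaSymbolAt v = .Istar 0 ∧ W.ordMinimalDiscriminant v = 9) ∨
      (W.kodairaSymbolAt v = .Istar 3 ∧ W.ordMinimalDiscriminant v = 12) ∨ (W.kodairaSymbolAt v = .IIIstar ∧ W.ordMinimalDiscriminant v = 12) := by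
  rcases kodairaSymbolAt_menu_of_conductorExponent_of_irreducible_two v W h2 (by norm_num) hf with
      ⟨hK, ho, hf⟩ | ⟨hK, ho, hf⟩ | ⟨hK, ho, hf⟩ | ⟨hK, ho, hf⟩ | ⟨hK, ho, hf⟩ | ⟨hK, ho, hf⟩ | ⟨hK, ho, hf⟩ | ⟨n, hn, hK, ho, hf⟩ |
      ⟨hK, ho, hf⟩ | ⟨hK, ho, hf⟩ | ⟨hK, ho, hf⟩ <;>
    first
      | exact Or.inl ⟨hK, ho⟩
      | exact Or.inr (Or.inl ⟨hK, ho⟩)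
      | exact Or.inr (Or.inr (Or.inl ⟨hK, ho⟩))
      | exact Or.inr (Or.inr (Or.inr ⟨hK, ho⟩))
      | (exfalso; omega)

/-- **`f_v = 6` ⟹ `II/6`, `I₀*/10`, `I₂*/12`, `II*/14` or `Iₙ*/(n+10)` with `n ≥ 4`.** [cite: Papadopoulos1993, Table IV (p = 2)] -/
theorem kodairaSymbolAt_of_conductorExponent_eq_six_of_irreducible_two [W.IsElliptic]
    [PerfectField (IsLocalRing.ResidueField (v.adicCompletionIntegers K))]
    (h2 : Irreducible (2 : v.adicCompletionIntegers K)) (hf : W.conductorExponent v = 6) :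
    (W.kodairaSymbolAt v = .II ∧ W.ordMinimalDiscriminant v = 6) ∨ (W.kodairaSymbolAt v = .Istar 0 ∧ W.ordMinimalDiscriminant v = 10) ∨
      (W.kodairaSymbolAt v = .Istar 2 ∧ W.ordMinimalDiscriminant v = 12) ∨ (W.kodairaSymbolAt v = .IIstar ∧ W.ordMinimalDiscriminant v = 14) ∨
      (∃ n : ℕ, 4 ≤ n ∧ W.kodairaSymbolAt v = .Istar n ∧ W.ordMinimalDiscriminant v = n + 10) := by
  rcases kodairaSymbolAt_menu_of_conductorExponent_of_irreducible_two v W h2 (by norm_num) hf with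
      ⟨hK, ho, hf⟩ | ⟨hK, ho, hf⟩ | ⟨hK, ho, hf⟩ | ⟨hK, ho, hf⟩ | ⟨hK, ho, hf⟩ | ⟨hK, ho, hf⟩ | ⟨hK, ho, hf⟩ | ⟨n, hn, hK, ho, hf⟩ |
      ⟨hK, ho, hf⟩ | ⟨hK, ho, hf⟩ | ⟨hK, ho, hf⟩ <;>
    first
      | exact Or.inl ⟨hK, ho⟩
      | exact Or.inr (Or.inl ⟨hK, ho⟩)
      | exact Or.inr (Or.inr (Or.inl ⟨hK, ho⟩))
      | exact Or.inr (Or.inr (Or.inr (Or.inl ⟨hK, ho⟩)))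
      | exact Or.inr (Or.inr (Or.inr (Or.inr ⟨n, hn, hK, by omega⟩)))
      | (exfalso; omega)

/-- **`f_v = 7` ⟹ `II/7`, `III/8`, `I₂*/13` or `III*/14`.** [cite: Papadopoulos1993, Table IV (p = 2)] [cite: SilvermanATAEC1994, IV.11.1] -/
theorem kodairaSymbolAt_of_conductorExponent_eq_seven_of_irreducible_two [W.IsElliptic]
    [PerfectField (IsLocalRing.ResidueField (v.adicCompletionIntegers K))]
    (h2 : Irreducible (2 : v.adicCompletionIntegers K)) (hf : W.conductorExponent v = 7) :
    (W.kodairaSymbolAt v = .II ∧ W.ordMinimalDiscriminant v = 7) ∨ (W.kodairaSymbolAt v = .III ∧ W.ordMinimalDiscriminant v = 8) ∨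
      (W.kodairaSymbolAt v = .Istar 2 ∧ W.ordMinimalDiscriminant v = 13) ∨ (W.kodairaSymbolAt v = .IIIstar ∧ W.ordMinimalDiscriminant v = 14) := by
  rcases kodairaSymbolAt_menu_of_conductorExponent_of_irreducible_two v W h2 (by norm_num) hf with
      ⟨hK, ho, hf⟩ | ⟨hK, ho, hf⟩ | ⟨hK, ho, hf⟩ | ⟨hK, ho, hf⟩ | ⟨hK, ho, hf⟩ | ⟨hK, ho, hf⟩ | ⟨hK, ho, hf⟩ | ⟨n, hn, hK, ho, hf⟩ |
      ⟨hK, ho, hf⟩ | ⟨hK, ho, hf⟩ | ⟨hK, ho, hf⟩ <;>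
    first
      | exact Or.inl ⟨hK, ho⟩
      | exact Or.inr (Or.inl ⟨hK, ho⟩)
      | exact Or.inr (Or.inr (Or.inl ⟨hK, ho⟩))
      | exact Or.inr (Or.inr (Or.inr ⟨hK, ho⟩))
      | (exfalso; omega)

/-- **`f_v = 8` ⟹ `III/9` or `III*/15`** (the maximal conductor exponent at an absolutely unramified `2`-adic place).
[cite: Papadopoulos1993, Table IV (p = 2)] [cite: SilvermanATAEC1994, IV.11.1] -/
theorem kodairaSymbolAt_of_conductorExponent_eq_eight_of_irreducible_two [W.IsElliptic]
    [PerfectField (IsLocalRing.ResidueField (v.adicCompletionIntegers K))]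
    (h2 : Irreducible (2 : v.adicCompletionIntegers K)) (hf : W.conductorExponent v = 8) :
    (W.kodairaSymbolAt v = .III ∧ W.ordMinimalDiscriminant v = 9) ∨ (W.kodairaSymbolAt v = .IIIstar ∧ W.ordMinimalDiscriminant v = 15) := by
  rcases kodairaSymbolAt_menu_of_conductorExponent_of_irreducible_two v W h2 (by norm_num) hf with
      ⟨hK, ho, hf⟩ | ⟨hK, ho, hf⟩ | ⟨hK, ho, hf⟩ | ⟨hK, ho, hf⟩ | ⟨hK, ho, hf⟩ | ⟨hK, ho, hf⟩ | ⟨hK, ho, hf⟩ | ⟨n, hn, hK, ho, hf⟩ |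
      ⟨hK, ho, hf⟩ | ⟨hK, ho, hf⟩ | ⟨hK, ho, hf⟩ <;>
    first
      | exact Or.inl ⟨hK, ho⟩
      | exact Or.inr ⟨hK, ho⟩
      | (exfalso; omega)

end Local

/-! ## Over `ℚ` at the place of `ℤ` above `2` -/

section Rat

open IsDedekindDomain

variable (W : WeierstrassCurve ℚ) [W.IsElliptic] (v : HeightOneSpectrum ℤ) (hv : Rat.HeightOneSpectrum.natGenerator v = 2)
include hv

/-- **The Papadopoulos menu at `2` over `ℚ`.** [cite: Papadopoulos1993, Table IV (p = 2)] [cite: SilvermanATAEC1994, IV.9.4 and Table 4.1] -/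
theorem kodairaSymbolAt_ordMinimalDiscriminant_menu_two (hadd : (W.kodairaSymbolAt v).IsAdditive) :
    (W.kodairaSymbolAt v = .II ∧ (W.ordMinimalDiscriminant v = 4 ∨ W.ordMinimalDiscriminant v = 6 ∨ W.ordMinimalDiscriminant v = 7)) ∨
    (W.kodairaSymbolAt v = .III ∧ (W.ordMinimalDiscriminant v = 4 ∨ W.ordMinimalDiscriminant v = 6 ∨ W.ordMinimalDiscriminant v = 8 ∨
      W.ordMinimalDiscriminant v = 9)) ∨
    (W.kodairaSymbolAt v = .IV ∧ W.ordMinimalDiscriminant v = 4) ∨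
    (W.kodairaSymbolAt v = .Istar 0 ∧ (W.ordMinimalDiscriminant v = 8 ∨ W.ordMinimalDiscriminant v = 9 ∨ W.ordMinimalDiscriminant v = 10)) ∨
    (W.kodairaSymbolAt v = .Istar 1 ∧ W.ordMinimalDiscriminant v = 8) ∨
    (W.kodairaSymbolAt v = .Istar 2 ∧ (W.ordMinimalDiscriminant v = 10 ∨ W.ordMinimalDiscriminant v = 12 ∨ W.ordMinimalDiscriminant v = 13)) ∨
    (W.kodairaSymbolAt v = .Istar 3 ∧ (W.ordMinimalDiscriminant v = 11 ∨ W.ordMinimalDiscriminant v = 12)) ∨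
    (∃ n : ℕ, 4 ≤ n ∧ W.kodairaSymbolAt v = .Istar n ∧ (W.ordMinimalDiscriminant v = n + 8 ∨ W.ordMinimalDiscriminant v = n + 10)) ∨
    (W.kodairaSymbolAt v = .IVstar ∧ W.ordMinimalDiscriminant v = 8) ∨
    (W.kodairaSymbolAt v = .IIIstar ∧ (W.ordMinimalDiscriminant v = 10 ∨ W.ordMinimalDiscriminant v = 12 ∨ W.ordMinimalDiscriminant v = 14 ∨
      W.ordMinimalDiscriminant v = 15)) ∨
    (W.kodairaSymbolAt v = .IIstar ∧ (W.ordMinimalDiscriminant v = 11 ∨ W.ordMinimalDiscriminant v = 12 ∨ W.ordMinimalDiscriminant v = 14)) :=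
  kodairaSymbolAt_ordMinimalDiscriminant_menu_of_irreducible_two v W (irreducible_two_adicCompletionIntegers_of_natGenerator_eq_two v hv) hadd

/-- **`f₂ = 5` over `ℚ` ⟹ `III/6`, `I₀*/9`, `I₃*/12` or `III*/12`.** [cite: Papadopoulos1993, Table IV (p = 2)] -/
theorem kodairaSymbolAt_of_conductorExponent_eq_five_two (hf : W.conductorExponent v = 5) :
    (W.kodairaSymbolAt v = .III ∧ W.ordMinimalDiscriminant v = 6) ∨ (W.kodairaSymbolAt v = .Istar 0 ∧ W.ordMinimalDiscriminant v = 9) ∨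
      (W.kodairaSymbolAt v = .Istar 3 ∧ W.ordMinimalDiscriminant v = 12) ∨ (W.kodairaSymbolAt v = .IIIstar ∧ W.ordMinimalDiscriminant v = 12) :=
  kodairaSymbolAt_of_conductorExponent_eq_five_of_irreducible_two v W (irreducible_two_adicCompletionIntegers_of_natGenerator_eq_two v hv) hf

/-- **`f₂ = 6` over `ℚ` ⟹ `II/6`, `I₀*/10`, `I₂*/12`, `II*/14` or `Iₙ*/(n+10)`, `n ≥ 4`.** [cite: Papadopoulos1993, Table IV (p = 2)] -/
theorem kodairaSymbolAt_of_conductorExponent_eq_six_two (hf : W.conductorExponent v = 6) :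
    (W.kodairaSymbolAt v = .II ∧ W.ordMinimalDiscriminant v = 6) ∨ (W.kodairaSymbolAt v = .Istar 0 ∧ W.ordMinimalDiscriminant v = 10) ∨
      (W.kodairaSymbolAt v = .Istar 2 ∧ W.ordMinimalDiscriminant v = 12) ∨ (W.kodairaSymbolAt v = .IIstar ∧ W.ordMinimalDiscriminant v = 14) ∨
      (∃ n : ℕ, 4 ≤ n ∧ W.kodairaSymbolAt v = .Istar n ∧ W.ordMinimalDiscriminant v = n + 10) :=
  kodairaSymbolAt_of_conductorExponent_eq_six_of_irreducible_two v W (irreducible_two_adicCompletionIntegers_of_natGenerator_eq_two v hv) hf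

/-- **`f₂ = 7` over `ℚ` ⟹ `II/7`, `III/8`, `I₂*/13` or `III*/14`.** [cite: Papadopoulos1993, Table IV (p = 2)] -/
theorem kodairaSymbolAt_of_conductorExponent_eq_seven_two (hf : W.conductorExponent v = 7) :
    (W.kodairaSymbolAt v = .II ∧ W.ordMinimalDiscriminant v = 7) ∨ (W.kodairaSymbolAt v = .III ∧ W.ordMinimalDiscriminant v = 8) ∨
      (W.kodairaSymbolAt v = .Istar 2 ∧ W.ordMinimalDiscriminant v = 13) ∨ (W.kodairaSymbolAt v = .IIIstar ∧ W.ordMinimalDiscriminant v = 14) :=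
  kodairaSymbolAt_of_conductorExponent_eq_seven_of_irreducible_two v W (irreducible_two_adicCompletionIntegers_of_natGenerator_eq_two v hv) hf

/-- **`f₂ = 8` over `ℚ` ⟹ `III/9` or `III*/15`.** [cite: Papadopoulos1993, Table IV (p = 2)] -/
theorem kodairaSymbolAt_of_conductorExponent_eq_eight_two (hf : W.conductorExponent v = 8) :
    (W.kodairaSymbolAt v = .III ∧ W.ordMinimalDiscriminant v = 9) ∨ (W.kodairaSymbolAt v = .IIIstar ∧ W.ordMinimalDiscriminant v = 15) :=
  kodairaSymbolAt_of_conductorExponent_eq_eight_of_irreducible_two v W (irreducible_two_adicCompletionIntegers_of_natGenerator_eq_two v hv) hf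

end Rat

end Summit.BirchSwinnertonDyer.BirchSwinnertonDyer.Theorems.ManinLocalTwoThree

end
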